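import Summits.Ventures.CertifiedManyBodySolver.Theorems.M3x2EdgeSplitSymReplayBoxCanon
import HarnessLib

/-!
# SymReplay gramR — OUTROUTE (T20a): partial-free sharding of the local R-residual by an OUTPUT KEY — soundness

Every sharded landing so far ships, per shard `j`, a PARTIAL literal `P_j` (the canonical form of the shard) and closes with
`isZero (canon (P_0 ++ … ++ P_m))`; on an E-class certificate each Gram-group partial is ≈ 0.68·nvar terms, so `J ≥ 50` shards
cost gigabytes of shipped literals.  OUTROUTE ships NO partial: module `i < J` re-enumerates the raw local residual
`LHS − RHS_R` (products of short words) but normal-orders, collects and canonicalises ONLY the raw terms whose OUTPUT KEY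
`κ w % J` is `i`, and checks that this share ALONE canonicalises to zero.

SOUNDNESS needs nothing of `κ`: the slot filter acts on the RAW term list, so the shares are a PARTITION of it
(`sum_sharesR`, exact for EVERY `κ : Word → ℕ`), their operator sum is `LHS − RHS_R`, and `J` facts «share `i` ≡ 0 modulo
identification uses» are `…LocalB`'s two-list facts `Facts₂Z` against the EMPTY partials `[[], …, []]`, which the generic
`wardD4CertGe_of_facts₂ZR` (`…GramRShardsGrouped`) closes.  COMPLETENESS (each share cancels on its own) is the producer's
business: it holds whenever `κ` factors through the word's NET MODE PATTERN `m ↦ #c†_m − #c_m` (invariant under normal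
ordering, `collect`, the affine-`D₄` canon and the identification uses); a bad key can only make a module's `native_decide`
fail, never certify a false bound.  §(d) gives two such keys (`netKey`, `pairKey`).

CONTENTS.  (a) list algebra: `pscale` / `filter` through `++` / `flatMap` / `ite`; the slot partition lemma
`sum_polyOp_filter_slots`; (b) the raw local R-residual `rawResidualR K` (never executed as a whole), its operator value and
support; (c) the EXECUTED share `shareR K κ J i` (filter pushed to the product leaves, block scalars folded) with
`shareR_eq : shareR K κ J i = (rawResidualR K).filter slot-i`, the per-module facts `outOKV` / `OutFacts` (frame-list canon)
and `outOKB` / `OutFactsB` (box canon under `boxLicence`, `…BoxCanon`), the closing theorems `wardD4CertGe_of_outroute(B)`,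
`energyDensity_ge_of_outroute(B)`; (d) keys `netKey`, `pairKey` (and the layout helpers they are made of).
The executed refinements (pushed base filter, bucketed modules, the fast-skeleton spec) and the kernel demos are in
`…OutRouteL`.

CLOSING GRAMMAR (R-literal `K`, literals `J`, `lo hi`):  `hwf : wellFormed K.expand = true`, `hbox : boxLicence K.frame lo hi
= true`, `hRok : K.gramR.all (gramBlockROK K.frame) = true` (from per-block box facts, `gramR_all_of_factsB`); per module
`out_i : outOKB K pairKey J lo hi i = true := by native_decide` (`i < J`; NO partial literal); close
`energyDensity_ge_of_outrouteB K hwf hRok pairKey J hJ lo hi hbox ⟨out_0, …, out_{J-1}, trivial⟩`.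

HONEST FRAMING: checker plumbing (a byte lever: zero shipped partials) with its soundness theorem; no certificate is replayed
here; no bound of record moves; no summit or crux statement is proved; nothing here predicts superconductivity.
-/

noncomputable section

namespace Summit.Ventures.CertifiedManyBodySolver.Theorems.SymReplay

open Matrix Finset
open Literature.MathematicalPhysics.QuantumLattice
open Literature.MathematicalPhysics.QuantumLattice.HubbardWave0
open Literature.MathematicalPhysics.QuantumLattice.ThermodynamicLimit
open Literature.Probability.LatticeModels
open Literature.MathematicalPhysics.QuantumManyBody.StateRelaxation
open Summit.Ventures.CertifiedManyBodySolver.Theorems.WardSlot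
open scoped ComplexOrder BigOperators

/-! ##### (a) List algebra: scalars and word filters through the polynomial constructors; the slot partition -/

/-- A term predicate that reads only the WORD (so it commutes with scaling). -/
def wordPred (Pw : Word → Bool) (t : ℚ × Word) : Bool := Pw t.2

/-- `pscale` distributes over `++`. -/
theorem pscale_append (q : ℚ) (p r : QPoly) : pscale q (p ++ r) = pscale q p ++ pscale q r := by
  rw [pscale, List.map_append]; rfl

/-- `pscale` goes through a `flatMap`. -/
theorem pscale_flatMap {α : Type} (q : ℚ) (l : List α) (f : α → QPoly) :
    pscale q (l.flatMap f) = l.flatMap fun a => pscale q (f a) := by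
  rw [pscale, List.map_flatMap]; rfl

/-- Iterated `pscale` multiplies the scalars. -/
theorem pscale_pscale (q q' : ℚ) (p : QPoly) : pscale q (pscale q' p) = pscale (q * q') p := by
  simp only [pscale, List.map_map, Function.comp_def, mul_assoc]

/-- `pscale` through an `if … then [] else …`. -/
theorem pscale_ite_nil (q : ℚ) (c : Prop) [Decidable c] (p : QPoly) :
    pscale q (if c then [] else p) = if c then [] else pscale q p := by
  split_ifs <;> rfl

/-- A filter through an `if … then [] else …`. -/
theorem filter_ite_nil {α : Type} (P : α → Bool) (c : Prop) [Decidable c] (l : List α) :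
    (if c then [] else l).filter P = if c then [] else l.filter P := by
  split_ifs <;> rfl

/-- A word filter commutes with `pscale` (the filter reads only the word). -/
theorem filter_pscale (Pw : Word → Bool) (q : ℚ) :
    ∀ (p : QPoly), (pscale q p).filter (wordPred Pw) = pscale q (p.filter (wordPred Pw))
  | [] => rfl
  | t :: p => by
    have ih := filter_pscale Pw q p
    rw [pscale] at ih ⊢
    rw [List.map_cons, List.filter_cons, List.filter_cons, ih]
    have e : wordPred Pw (q * t.1, t.2) = wordPred Pw t := rfl
    rw [e]
    split_ifs <;> rfl

/-- Filtering keeps supports. -/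
theorem PSupp.filter {p : QPoly} {Λ : Finset (Site 2)} (hp : PSupp p Λ) (P : ℚ × Word → Bool) :
    PSupp (p.filter P) Λ :=
  fun t ht => hp t (List.mem_of_mem_filter ht)

/-- The slot of a word under key `κ` with `J` modules. -/
def slotOf (κ : Word → ℕ) (J : ℕ) (w : Word) : ℕ := κ w % J

/-- A slot index is `< J` when `0 < J`. -/
theorem slotOf_lt (κ : Word → ℕ) {J : ℕ} (hJ : 0 < J) (w : Word) : slotOf κ J w < J := Nat.mod_lt _ hJ

/-- Word test «slot = `i`». -/
def inSlotW (κ : Word → ℕ) (J i : ℕ) (w : Word) : Bool := slotOf κ J w == i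

/-- The slot test as an equation on `slotOf`. -/
theorem wordPred_inSlotW_iff (κ : Word → ℕ) (J i : ℕ) (t : ℚ × Word) :
    wordPred (inSlotW κ J i) t = true ↔ slotOf κ J t.2 = i := by
  simp [wordPred, inSlotW]

/-- A sum of `if k = i then x else 0` over indices all different from `k` vanishes. -/
theorem sum_map_ite_eq_zero {M : Type} [AddCommMonoid M] (x : M) (k : ℕ) :
    ∀ (l : List ℕ), (∀ i ∈ l, i ≠ k) → (l.map fun i => if k = i then x else 0).sum = 0
  | [], _ => rfl
  | i :: l, h => by
    rw [List.map_cons, List.sum_cons, if_neg (fun e => h i List.mem_cons_self e.symm), zero_add,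
      sum_map_ite_eq_zero x k l (fun j hj => h j (List.mem_cons_of_mem _ hj))]

/-- Exactly one index of `range J` is hit. -/
theorem sum_range_ite_eq {M : Type} [AddCommMonoid M] (x : M) :
    ∀ (J k : ℕ), k < J → ((List.range J).map fun i => if k = i then x else 0).sum = x
  | 0, k, hk => absurd hk (Nat.not_lt_zero k)
  | J + 1, k, hk => by
    rw [List.range_succ, List.map_append, List.sum_append, List.map_cons, List.map_nil, List.sum_cons, List.sum_nil,
      add_zero]
    by_cases hkJ : k = J
    · subst hkJ
      rw [if_pos rfl, sum_map_ite_eq_zero x k (List.range k) (fun i hi => Nat.ne_of_lt (List.mem_range.1 hi)), zero_add]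
    · rw [sum_range_ite_eq x J k (by omega), if_neg hkJ, add_zero]

/-- One term through the slot filters. -/
theorem polyOp_filter_cons_slot (Λ' : Finset (Site 2)) (κ : Word → ℕ) (J i : ℕ) (t : ℚ × Word) (R : QPoly) :
    polyOp Λ' ((t :: R).filter (wordPred (inSlotW κ J i))) =
      (if slotOf κ J t.2 = i then ((t.1 : ℚ) : ℂ) • wordOp Λ' t.2 else 0) +
        polyOp Λ' (R.filter (wordPred (inSlotW κ J i))) := by
  rw [List.filter_cons]
  by_cases h : slotOf κ J t.2 = i
  · rw [if_pos ((wordPred_inSlotW_iff κ J i t).2 h), if_pos h, polyOp_cons]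
  · rw [if_neg (fun hb => h ((wordPred_inSlotW_iff κ J i t).1 hb)), if_neg h, zero_add]

/-- **THE SLOT PARTITION**: the `J` slot filters of a term list sum, as operators, to the whole list. -/
theorem sum_polyOp_filter_slots (Λ' : Finset (Site 2)) (κ : Word → ℕ) {J : ℕ} (hJ : 0 < J) :
    ∀ (R : QPoly), ((List.range J).map fun i => polyOp Λ' (R.filter (wordPred (inSlotW κ J i)))).sum = polyOp Λ' R
  | [] => by simp
  | t :: R => by
    simp only [polyOp_filter_cons_slot]
    rw [List.sum_map_add, sum_polyOp_filter_slots Λ' κ hJ R, sum_range_ite_eq _ J _ (slotOf_lt κ hJ t.2), polyOp_cons]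

/-! ##### (b) The raw local R-residual (the term list being partitioned; never executed as a whole) -/

/-- The R-blocks' `rhsPolyR` slots `|moves_B| • D_B`. -/
def rPart (K : SymCertR) : QPoly := K.gramR.flatMap fun B => pscale (B.moves.length : ℚ) (gramBlockPolyR B)

/-- **The raw local R-residual** `LHS −ₗ (RHS_L-without-blocks ++ gramM blocks ++ R slots)` — a plain term list. -/
def rawResidualR (K : SymCertR) : QPoly :=
  psub (lhsPoly K.toSymCert) (rhsNonBlockL K.toSymCert ++ K.gramM.flatMap gramBlockPoly ++ rPart K)

/-- Its operator value is `LHS − RHS_R` in every window containing the frame. -/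
theorem polyOp_rawResidualR (K : SymCertR) (hwf : wellFormed K.toSymCert = true) {Λ' : Finset (Site 2)}
    (hFL : K.frame.toFinset ⊆ Λ') :
    polyOp Λ' (rawResidualR K) = polyOp Λ' (lhsPoly K.toSymCert) - polyOp Λ' (rhsPolyR K) := by
  rw [rawResidualR, polyOp_psub, polyOp_append, polyOp_append, ← polyOp_rhsPolyL_split,
    polyOp_rhsPolyL_eq K.toSymCert hwf hFL, rhsPolyR, polyOp_append, rPart]

/-- It is supported in the frame. -/
theorem PSupp_rawResidualR (K : SymCertR) (hwf : wellFormed K.toSymCert = true)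
    (hRok : K.gramR.all (gramBlockROK K.frame) = true) : PSupp (rawResidualR K) K.frame.toFinset := by
  have hsD := supp_of_gramROK K hRok
  refine (PSupp_lhsPoly K.toSymCert (thicken_zero_subset_of_wellFormed K.toSymCert hwf)).psub
    (((PSupp_rhsNonBlockL K.toSymCert hwf).append ?_).append ?_)
  · intro t ht
    apply PSupp_rhsPolyL K.toSymCert hwf t
    simp only [rhsPolyL, List.mem_append]
    tauto
  · exact PSupp.flatMap _ _ fun B hB => (PSupp_gramBlockPolyR B (hsD B hB).1 (hsD B hB).2).pscale _

/-! ##### (c) The EXECUTED share of module `i`, the per-module facts, the closing theorems -/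

/-- **Share of module `i`** (`i < J`): the raw residual terms of slot `i` — base terms filtered; R-products filtered AT THE LEAF
(per pair `(a, b)` only `|a|·|b|` short-lived terms exist before the filter), block scalars `−|moves|·scale·g` folded into one
`pscale` of the kept terms; `genBasis B` computed once per block. -/
def shareR (K : SymCertR) (κ : Word → ℕ) (J i : ℕ) : QPoly :=
  let P := wordPred (inSlotW κ J i)
  (baseShardL K.toSymCert).filter P ++
  ((pscale (-1) (K.gramM.flatMap gramBlockPoly)).filter P ++
  K.gramR.flatMap fun B =>
    let qr := (genBasis B).zip B.rows
    let m : ℚ := (B.moves.length : ℚ)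
    (B.reps.zip B.rows).flatMap fun a =>
      let ua := padj a.1
      qr.flatMap fun b =>
        let g := sdot a.2 b.2
        if g = 0 then [] else pscale (-1 * (m * (B.scale * g))) ((pmul ua b.1).filter P))

/-- **The executed share IS slot `i` of the raw residual** (list equality). -/
theorem shareR_eq (K : SymCertR) (κ : Word → ℕ) (J i : ℕ) :
    shareR K κ J i = (rawResidualR K).filter (wordPred (inSlotW κ J i)) := by
  simp only [shareR, rawResidualR, rPart, baseShardL, psub, gramBlockPolyR, pscale_append, pscale_flatMap, pscale_pscale,
    pscale_ite_nil, List.filter_append, List.filter_flatMap, filter_ite_nil, filter_pscale, List.append_assoc]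

/-- The shares, `i = 0 … J−1`. -/
def sharesR (K : SymCertR) (κ : Word → ℕ) (J : ℕ) : List QPoly := (List.range J).map (shareR K κ J)

/-- The shares sum to `LHS − RHS_R` (in every window containing the frame). -/
theorem sum_sharesR (K : SymCertR) (hwf : wellFormed K.toSymCert = true) (κ : Word → ℕ) {J : ℕ} (hJ : 0 < J)
    {Λ' : Finset (Site 2)} (hFL : K.frame.toFinset ⊆ Λ') :
    ((sharesR K κ J).map (polyOp Λ')).sum = polyOp Λ' (lhsPoly K.toSymCert) - polyOp Λ' (rhsPolyR K) := by
  rw [sharesR, List.map_map, ← polyOp_rawResidualR K hwf hFL, ← sum_polyOp_filter_slots Λ' κ hJ (rawResidualR K)]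
  simp only [Function.comp_def, shareR_eq]

/-- Every share is supported in the frame. -/
theorem PSupp_sharesR (K : SymCertR) (hwf : wellFormed K.toSymCert = true)
    (hRok : K.gramR.all (gramBlockROK K.frame) = true) (κ : Word → ℕ) (J : ℕ) :
    ∀ Q ∈ sharesR K κ J, PSupp Q K.frame.toFinset := by
  intro Q hQ
  rw [sharesR, List.mem_map] at hQ
  obtain ⟨i, -, rfl⟩ := hQ
  rw [shareR_eq]
  exact (PSupp_rawResidualR K hwf hRok).filter _

/-- **What ONE farm call proves about module `i`**: its share canonicalises to zero (zero-filtered executed pipe; NO partial). -/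
def outOKV (K : SymCertR) (κ : Word → ℕ) (J i : ℕ) : Bool := isZero (canonNFZV K.frame (shareR K κ J i))

/-- The per-module facts for slots `i, …, i+n−1` (structural on the count `n`). -/
def OutFacts (K : SymCertR) (κ : Word → ℕ) (J : ℕ) : ℕ → ℕ → Prop
  | _, 0 => True
  | i, n + 1 => outOKV K κ J i = true ∧ OutFacts K κ J (i + 1) n

/-- Subtracting the empty polynomial. -/
theorem psub_nil (p : QPoly) : psub p [] = p := by
  rw [psub, pscale, List.map_nil, List.append_nil]

/-- The empty polynomial passes the identity test. -/
theorem isZero_canonNFZV_nil (frame : List (Site 2)) : isZero (canonNFZV frame []) = true := rfl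

/-- Per-module facts give `…LocalB`'s two-list facts against EMPTY partials. -/
theorem facts₂Z_of_outFacts (K : SymCertR) (κ : Word → ℕ) (J : ℕ) :
    ∀ (n i : ℕ), OutFacts K κ J i n →
      Facts₂Z K.toSymCert ((List.range' i n).map (shareR K κ J)) (List.replicate n []) := by
  intro n
  induction n with
  | zero => intro i _; exact trivial
  | succ n ih =>
    intro i h
    rw [List.range'_succ, List.map_cons, List.replicate_succ]
    refine ⟨?_, ih (i + 1) h.2⟩
    rw [Bool.and_eq_true, psub_nil]
    exact ⟨rfl, h.1⟩

/-- **OUTROUTE IS SOUND**: `J` per-module facts (and the usual side conditions) certify `WardD4CertGe (symValueR K)`. -/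
theorem wardD4CertGe_of_outroute (K : SymCertR) (hwf0 : wellFormed K.expand = true)
    (hRok : K.gramR.all (gramBlockROK K.frame) = true) (κ : Word → ℕ) (J : ℕ) (hJ : 0 < J)
    (hfacts : OutFacts K κ J 0 J) : WardD4CertGe ((symValueR K : ℚ) : ℝ) := by
  have hwfb : wellFormed K.toSymCert = true := wellFormed_toSymCert_of_expand K hwf0
  refine wardD4CertGe_of_facts₂ZR K hwf0 hRok (sharesR K κ J) (List.replicate J []) (PSupp_sharesR K hwfb hRok κ J)
    (fun Λ' hFL => sum_sharesR K hwfb κ hJ hFL) ?_ ?_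
  · rw [sharesR, List.range_eq_range']
    exact facts₂Z_of_outFacts K κ J J 0 hfacts
  · rw [List.flatten_replicate_nil]
    exact isZero_canonNFZV_nil K.frame

/-- **OUTROUTE closing theorem**: `symValueR K ≤ e₀(1,0,8,7/8)`.  CLOSING GRAMMAR: per module `i < J` one file
`theorem out_i : outOKV K κ J i = true := by native_decide`; then `hfacts : OutFacts K κ J 0 J := ⟨out_0, …, out_{J−1}, trivial⟩`. -/
theorem energyDensity_ge_of_outroute (K : SymCertR) (hwf : wellFormed K.expand = true)
    (hRok : K.gramR.all (gramBlockROK K.frame) = true) (κ : Word → ℕ) (J : ℕ) (hJ : 0 < J)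
    (hfacts : OutFacts K κ J 0 J) : ((symValueR K : ℚ) : ℝ) ≤ energyDensityTT' 1 0 8 (7 / 8) :=
  energyDensity_ge_of_windowSound_cert _ WardSlot.stub_wardWindowSound (wardD4CertGe_of_outroute K hwf hRok κ J hJ hfacts)

/-! ###### Box-canon form (path of record for box frames, `…BoxCanon`) -/

/-- Per-module fact, box canon. -/
def outOKB (K : SymCertR) (κ : Word → ℕ) (J : ℕ) (lo hi : ℤ × ℤ) (i : ℕ) : Bool :=
  isZero (canonNFZB lo hi (shareR K κ J i))

/-- Under the licence the box per-module fact IS the frame-list fact. -/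
theorem outOKB_eq (K : SymCertR) (κ : Word → ℕ) (J : ℕ) {lo hi : ℤ × ℤ} (h : boxLicence K.frame lo hi = true) (i : ℕ) :
    outOKB K κ J lo hi i = outOKV K κ J i := by
  rw [outOKB, outOKV, canonNFZB_eq h]

/-- The per-module facts, box canon. -/
def OutFactsB (K : SymCertR) (κ : Word → ℕ) (J : ℕ) (lo hi : ℤ × ℤ) : ℕ → ℕ → Prop
  | _, 0 => True
  | i, n + 1 => outOKB K κ J lo hi i = true ∧ OutFactsB K κ J lo hi (i + 1) n

/-- Box per-module facts give the frame-list facts (structural). -/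
theorem outFacts_of_B (K : SymCertR) (κ : Word → ℕ) (J : ℕ) {lo hi : ℤ × ℤ} (h : boxLicence K.frame lo hi = true) :
    ∀ (n i : ℕ), OutFactsB K κ J lo hi i n → OutFacts K κ J i n := by
  intro n
  induction n with
  | zero => intro i _; exact trivial
  | succ n ih => intro i hf; exact ⟨(outOKB_eq K κ J h i).symm.trans hf.1, ih (i + 1) hf.2⟩

/-- **OUTROUTE with the box licence is sound** … -/
theorem wardD4CertGe_of_outrouteB (K : SymCertR) (hwf : wellFormed K.expand = true)
    (hRok : K.gramR.all (gramBlockROK K.frame) = true) (κ : Word → ℕ) (J : ℕ) (hJ : 0 < J) (lo hi : ℤ × ℤ)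
    (hbox : boxLicence K.frame lo hi = true) (hfacts : OutFactsB K κ J lo hi 0 J) :
    WardD4CertGe ((symValueR K : ℚ) : ℝ) :=
  wardD4CertGe_of_outroute K hwf hRok κ J hJ (outFacts_of_B K κ J hbox J 0 hfacts)

/-- … and the energy-density bound (grammar in the module docstring). -/
theorem energyDensity_ge_of_outrouteB (K : SymCertR) (hwf : wellFormed K.expand = true)
    (hRok : K.gramR.all (gramBlockROK K.frame) = true) (κ : Word → ℕ) (J : ℕ) (hJ : 0 < J) (lo hi : ℤ × ℤ)
    (hbox : boxLicence K.frame lo hi = true) (hfacts : OutFactsB K κ J lo hi 0 J) :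
    ((symValueR K : ℚ) : ℝ) ≤ energyDensityTT' 1 0 8 (7 / 8) :=
  energyDensity_ge_of_windowSound_cert _ WardSlot.stub_wardWindowSound
    (wardD4CertGe_of_outrouteB K hwf hRok κ J hJ lo hi hbox hfacts)

/-! ##### (d) Output keys (any `κ : Word → ℕ` is SOUND; these two are functions of the net mode pattern through affine-`D₄`
invariants, hence COMPLETE — each share cancels alone whenever the whole residual does) -/

/-- Net mode table of a word: entries `(x 0, x 1, spin, net)` with `net = #c† − #c` at that mode (letter order irrelevant
up to the order of the table, which the keys below sum away). -/
def netAdd (x0 x1 : ℤ) (s : ℕ) (d : ℤ) : List (ℤ × ℤ × ℕ × ℤ) → List (ℤ × ℤ × ℕ × ℤ)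
  | [] => [(x0, x1, s, d)]
  | e :: tb => if e.1 = x0 ∧ e.2.1 = x1 ∧ e.2.2.1 = s then (x0, x1, s, e.2.2.2 + d) :: tb else e :: netAdd x0 x1 s d tb

/-- The net mode table (zero-net modes dropped). -/
def netModes (w : Word) : List (ℤ × ℤ × ℕ × ℤ) :=
  (w.foldl (fun tb ℓ => netAdd (ℓ.x 0) (ℓ.x 1) ℓ.s.val (if ℓ.dag then 1 else -1) tb) []).filter fun e => !decide (e.2.2.2 = 0)

/-- Code of one net mode (position-free): spin and net occupation change. -/
def modeCode (e : ℤ × ℤ × ℕ × ℤ) : ℕ := 1 + 2 * e.2.2.1 + 5 * (e.2.2.2 + 4).toNat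

/-- Code of an unordered pair of net modes: squared distance (an affine-`D₄` invariant), spins, nets — symmetric in the pair. -/
def pairCode (e f : ℤ × ℤ × ℕ × ℤ) : ℕ :=
  let d2 := ((e.1 - f.1) * (e.1 - f.1) + (e.2.1 - f.2.1) * (e.2.1 - f.2.1)).toNat
  7 + 31 * d2 + 3 * (modeCode e + modeCode f) + modeCode e * modeCode f

/-- Sum of `pairCode` over unordered pairs of a table. -/
def pairSum : List (ℤ × ℤ × ℕ × ℤ) → ℕ
  | [] => 0
  | e :: tb => (tb.map (pairCode e)).sum + pairSum tb

/-- **Coarse key**: the multiset of net modes, positions forgotten. -/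
def netKey (w : Word) : ℕ := ((netModes w).map modeCode).sum

/-- **Fine key**: coarse key plus the pair-distance structure of the net pattern (E(2)-invariant data only). -/
def pairKey (w : Word) : ℕ := netKey w + 1000 * pairSum (netModes w)

/-- A SOUND BUT INCOMPLETE key, for contrast: word length is not invariant under normal ordering (contractions shorten words). -/
def lenKey (w : Word) : ℕ := w.length

end Summit.Ventures.CertifiedManyBodySolver.Theorems.SymReplay

end

/-! ########## LANDING FILE 2 BEGINS HERE: `Theorems/M3x2EdgeSplitSymReplayOutRouteL.lean` (T20b) — in the real file the text below is preceded by
`import Summits.Ventures.CertifiedManyBodySolver.Theorems.M3x2EdgeSplitSymReplayOutRoute` + `import HarnessLib` and its module docstring (see pub copy). ########## -/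

/-!
# SymReplay gramR — OUTROUTE (T20b): executed refinements, the fast-skeleton spec, kernel demos

On top of `…OutRoute` (soundness of partial-free sharding by an output key; every name there):
(e) kernel demos on `toyRCert` (`J = 1` any key; `J = 3` fine key, frame-list canon; `J = 3` coarse key, box canon; share
sizes; the non-example of a length key: sound, not complete);
(f) PUSHED BASE FILTER `baseShareF` / `shareRWith` / `shareRF` — nothing of the base residual is built whole, the generated
bases are supplied once per module — with `shareRF_eq : shareRF K (K.gramR.map genBasis) κ J i = shareR K κ J i`;
(g) BUCKETED modules `outOKVL` / `outOKBL K κ J L [lo hi] i`: module `i` of `J` checks the `L` fine slots `L·i, …, L·i+L−1`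
of the `J·L`-slot partition one after the other (peak memory ≈ one fine slot, one `genBasis` pass per module), `OutFactsL` /
`OutFactsBL`, `wardD4CertGe_of_outrouteL`, `energyDensity_ge_of_outrouteBL`;
(h) the SPEC for a fast skeleton: for ANY executed share function `S : ℕ → QPoly` with `∀ i < J, (S i).Perm (shareR K κ J i)`
the `J` facts `isZero (canonNFZ[V|B] … (S i))` close (`OutFactsS[B]`, `wardD4CertGe_of_outrouteS`,
`energyDensity_ge_of_outrouteSB`) — an engine's allocation-free `shareRFast` owes exactly that permutation lemma for ITS key;
(i) toys: the bucketed form end to end (`J = 1`, `L = 3`, box canon) and the spec theorem instantiated with `S := shareRF …`.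

CLOSING GRAMMAR (bucketed, box canon; literals `J L lo hi`): per module
`out_i : outOKBL K pairKey J L lo hi i = true := by native_decide` (`i < J`), then
`energyDensity_ge_of_outrouteBL K hwf hRok pairKey J L hJ hL lo hi hbox ⟨out_0, …, out_{J-1}, trivial⟩`.

HONEST FRAMING: checker plumbing; no certificate is replayed here; no bound of record moves; no summit or crux statement is
proved; nothing here predicts superconductivity.
-/

noncomputable section

namespace Summit.Ventures.CertifiedManyBodySolver.Theorems.SymReplay

open Matrix Finset
open Literature.MathematicalPhysics.QuantumLattice
open Literature.MathematicalPhysics.QuantumLattice.HubbardWave0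
open Literature.MathematicalPhysics.QuantumLattice.ThermodynamicLimit
open Literature.Probability.LatticeModels
open Literature.MathematicalPhysics.QuantumManyBody.StateRelaxation
open Summit.Ventures.CertifiedManyBodySolver.Theorems.WardSlot
open scoped ComplexOrder BigOperators

/-! ##### (e) Kernel demos on `toyRCert` -/

/-- `J = 1`: the single share is the whole raw residual (any key): the one-call local R-check in OUTROUTE clothing. -/
example : ((symValueR toyRCert : ℚ) : ℝ) ≤ energyDensityTT' 1 0 8 (7 / 8) :=
  energyDensity_ge_of_outroute toyRCert (by decide +kernel)
    (gramR_all_of_facts toyRCert 2 (by decide +kernel) ⟨by decide +kernel, by decide +kernel, trivial⟩) lenKey 1 (by decide)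
    ⟨by decide +kernel, trivial⟩

/-- `J = 3` with the fine key: three modules, no partials. -/
example : ((symValueR toyRCert : ℚ) : ℝ) ≤ energyDensityTT' 1 0 8 (7 / 8) :=
  energyDensity_ge_of_outroute toyRCert (by decide +kernel)
    (gramR_all_of_facts toyRCert 2 (by decide +kernel) ⟨by decide +kernel, by decide +kernel, trivial⟩) pairKey 3 (by decide)
    ⟨by decide +kernel, by decide +kernel, by decide +kernel, trivial⟩

/-- `J = 3` with the coarse key and the BOX canon. -/
example : ((symValueR toyRCert : ℚ) : ℝ) ≤ energyDensityTT' 1 0 8 (7 / 8) :=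
  energyDensity_ge_of_outrouteB toyRCert (by decide +kernel)
    (gramR_all_of_factsB toyRCert (minCornerP frame3) (maxCornerP frame3) (by decide +kernel) 2 (by decide +kernel)
      ⟨by decide +kernel, by decide +kernel, trivial⟩)
    netKey 3 (by decide) (minCornerP frame3) (maxCornerP frame3) (by decide +kernel)
    ⟨by decide +kernel, by decide +kernel, by decide +kernel, trivial⟩

/-- Non-vacuity and the completeness caveat, on the toy (74 raw terms): the fine key splits them 36 / 28 / 10 and the coarse key
46 / 28 / 0, every share cancelling alone; the length key splits 2 / 2 / 70 and its modules 0 and 2 FAIL although the whole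
residual cancels (normal ordering moves a contraction's constant out of its raw term's length class) — soundness is untouched,
completeness is the key's job. -/
example : (sharesR toyRCert pairKey 3).map List.length = [36, 28, 10] ∧
    (List.range 3).map (outOKV toyRCert pairKey 3) = [true, true, true] ∧
    (sharesR toyRCert netKey 3).map List.length = [46, 28, 0] ∧
    (sharesR toyRCert lenKey 3).map List.length = [2, 2, 70] ∧
    (List.range 3).map (outOKV toyRCert lenKey 3) = [false, true, false] := by
  decide +kernel

/-! ##### (f) PUSHED BASE FILTER: nothing of the base residual is built whole

`baseShareF K♭ P` is `(baseShardL K♭).filter P` with the filter pushed into every summand of `LHS −ₗ rhsNonBlockL`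
(a commutator `[A, B]ₗ` contributes `(A·B)|P ++ (−1)·(B·A)|P`); `shareRF` = `shareR` with that base (list equality, so every
rev-1 theorem applies verbatim through `shareRF_eq`). -/

/-- The base share with the slot filter pushed to the summands. -/
def baseShareF (K : SymCert) (P : ℚ × Word → Bool) : QPoly :=
  (lhsPoly K).filter P ++
  pscale (-1)
    ((K.gram.flatMap fun g => pscale g.1 ((pmul (padj g.2) g.2).filter P)) ++
      (K.eom.flatMap fun B =>
        (pmul (hamPoly (localFrame B)) B).filter P ++ pscale (-1) ((pmul B (hamPoly (localFrame B))).filter P)) ++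
      (K.moves.flatMap fun mv => [(mv.z, moveWord mv.γ mv.v mv.u), (-mv.z, mv.u)].filter P) ++
      K.charged.filter P ++
      (K.wardP.flatMap fun X =>
        (pmul (spinPlusPoly (sitesOf X)) X).filter P ++ pscale (-1) ((pmul X (spinPlusPoly (sitesOf X))).filter P)) ++
      (K.wardM.flatMap fun X =>
        (pmul (spinMinusPoly (sitesOf X)) X).filter P ++ pscale (-1) ((pmul X (spinMinusPoly (sitesOf X))).filter P)) ++
      (K.antiH.flatMap fun t => pscale t.1 ((padj t.2).filter P ++ pscale (-1) (t.2.filter P))) ++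
      K.slack.filter P)

/-- The pushed base share IS the filtered base shard (list equality). -/
theorem baseShareF_eq (K : SymCert) (Pw : Word → Bool) :
    baseShareF K (wordPred Pw) = (baseShardL K).filter (wordPred Pw) := by
  simp only [baseShareF, baseShardL, rhsNonBlockL, psub, comm, List.filter_append, List.filter_flatMap, filter_pscale,
    pscale_append, pscale_flatMap, pscale_pscale, List.append_assoc]

/-- The R-part of a share with the generated bases SUPPLIED (`gbs`, one list per R-block, in block order) — so that a module
checking several fine slots generates the bases once. -/
def shareRWith (K : SymCertR) (gbs : List (List QPoly)) (P : ℚ × Word → Bool) : QPoly :=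
  (K.gramR.zip gbs).flatMap fun Bg =>
    let qr := Bg.2.zip Bg.1.rows
    let m : ℚ := (Bg.1.moves.length : ℚ)
    (Bg.1.reps.zip Bg.1.rows).flatMap fun a =>
      let ua := padj a.1
      qr.flatMap fun b =>
        let g := sdot a.2 b.2
        if g = 0 then [] else pscale (-1 * (m * (Bg.1.scale * g))) ((pmul ua b.1).filter P)

/-- `flatMap` over `l.zip (l.map f)` is a `flatMap` over `l`. -/
theorem flatMap_zip_map_self {α β γ : Type} (f : α → β) (F : α × β → List γ) :
    ∀ l : List α, (l.zip (l.map f)).flatMap F = l.flatMap fun a => F (a, f a)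
  | [] => rfl
  | a :: l => by rw [List.map_cons, List.zip_cons_cons, List.flatMap_cons, List.flatMap_cons, flatMap_zip_map_self f F l]

/-- **Executed share**: pushed base filter + supplied bases.  With `gbs = K.gramR.map genBasis` it IS `shareR`. -/
def shareRF (K : SymCertR) (gbs : List (List QPoly)) (κ : Word → ℕ) (J i : ℕ) : QPoly :=
  let P := wordPred (inSlotW κ J i)
  baseShareF K.toSymCert P ++
  (pscale (-1) (K.gramM.flatMap fun B => (gramBlockPoly B).filter P) ++
  shareRWith K gbs P)

/-- **The executed share with the generated bases passed in equals `shareR`** (so its facts are `shareR`'s facts). -/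
theorem shareRF_eq (K : SymCertR) (κ : Word → ℕ) (J i : ℕ) :
    shareRF K (K.gramR.map genBasis) κ J i = shareR K κ J i := by
  simp only [shareRF, shareR, shareRWith, baseShareF_eq, flatMap_zip_map_self, filter_pscale, List.filter_flatMap]

/-! ##### (g) BUCKETED MODULES: module `i` of `J` checks the `L` fine slots `L·i, …, L·i+L−1` of the `J·L`-slot
partition one after the other (bases generated ONCE per module; peak memory ≈ one fine slot's pipe; wall ≈ L skeleton passes
+ 1/J of the nf/collect/canon total).  Same soundness theorem, reached through `OutFacts K κ (J·L)`. -/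

/-- Module `i`'s bucketed check (V canon). -/
def outOKVL (K : SymCertR) (κ : Word → ℕ) (J L i : ℕ) : Bool :=
  let gbs := K.gramR.map genBasis
  (List.range L).all fun i' => isZero (canonNFZV K.frame (shareRF K gbs κ (J * L) (L * i + i')))

/-- Module `i`'s bucketed check (box canon — the one to run). -/
def outOKBL (K : SymCertR) (κ : Word → ℕ) (J L : ℕ) (lo hi : ℤ × ℤ) (i : ℕ) : Bool :=
  let gbs := K.gramR.map genBasis
  (List.range L).all fun i' => isZero (canonNFZB lo hi (shareRF K gbs κ (J * L) (L * i + i')))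

/-- Under the licence the bucketed box fact IS the bucketed frame-list fact. -/
theorem outOKBL_eq (K : SymCertR) (κ : Word → ℕ) (J L : ℕ) {lo hi : ℤ × ℤ} (h : boxLicence K.frame lo hi = true) (i : ℕ) :
    outOKBL K κ J L lo hi i = outOKVL K κ J L i := by
  simp only [outOKBL, outOKVL, canonNFZB_eq h]

/-- A bucketed fact gives the fine-slot fact of each of its `L` slots. -/
theorem outOKV_of_outOKVL (K : SymCertR) (κ : Word → ℕ) {J L i : ℕ} (h : outOKVL K κ J L i = true) {i' : ℕ} (hi' : i' < L) :
    outOKV K κ (J * L) (L * i + i') = true := by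
  simp only [outOKVL, List.all_eq_true, List.mem_range] at h
  rw [outOKV, ← shareRF_eq]
  exact h i' hi'

/-- The bucketed per-module facts for modules `i, …, i+n−1`. -/
def OutFactsL (K : SymCertR) (κ : Word → ℕ) (J L : ℕ) : ℕ → ℕ → Prop
  | _, 0 => True
  | i, n + 1 => outOKVL K κ J L i = true ∧ OutFactsL K κ J L (i + 1) n

/-- Bucketed box facts for modules `i, …, i+n−1` (structural on `n`). -/
def OutFactsBL (K : SymCertR) (κ : Word → ℕ) (J L : ℕ) (lo hi : ℤ × ℤ) : ℕ → ℕ → Prop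
  | _, 0 => True
  | i, n + 1 => outOKBL K κ J L lo hi i = true ∧ OutFactsBL K κ J L lo hi (i + 1) n

/-- Bucketed box facts give bucketed frame-list facts (structural). -/
theorem outFactsL_of_BL (K : SymCertR) (κ : Word → ℕ) (J L : ℕ) {lo hi : ℤ × ℤ} (h : boxLicence K.frame lo hi = true) :
    ∀ (n i : ℕ), OutFactsBL K κ J L lo hi i n → OutFactsL K κ J L i n := by
  intro n
  induction n with
  | zero => intro i _; exact trivial
  | succ n ih => intro i hf; exact ⟨(outOKBL_eq K κ J L h i).symm.trans hf.1, ih (i + 1) hf.2⟩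

/-- Fine-slot facts for a range, from a pointwise hypothesis. -/
theorem outFacts_of_forall (K : SymCertR) (κ : Word → ℕ) (N : ℕ) :
    ∀ (n a : ℕ), (∀ k, k < n → outOKV K κ N (a + k) = true) → OutFacts K κ N a n := by
  intro n
  induction n with
  | zero => intro a _; exact trivial
  | succ n ih =>
    intro a h
    refine ⟨by simpa using h 0 (Nat.succ_pos n), ih (a + 1) fun k hk => ?_⟩
    have := h (k + 1) (by omega)
    rwa [show a + (k + 1) = a + 1 + k by omega] at this

/-- Fine-slot facts of two adjacent ranges concatenate. -/
theorem outFacts_append (K : SymCertR) (κ : Word → ℕ) (N : ℕ) :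
    ∀ (m a n : ℕ), OutFacts K κ N a m → OutFacts K κ N (a + m) n → OutFacts K κ N a (m + n) := by
  intro m
  induction m with
  | zero => intro a n _ h; simpa using h
  | succ m ih =>
    intro a n h1 h2
    rw [show m + 1 + n = (m + n) + 1 by omega]
    exact ⟨h1.1, ih (a + 1) n h1.2 (by rwa [show a + 1 + m = a + (m + 1) by omega])⟩

/-- Bucketed module facts give the fine-slot facts. -/
theorem outFacts_of_L (K : SymCertR) (κ : Word → ℕ) (J L : ℕ) :
    ∀ (n i : ℕ), OutFactsL K κ J L i n → OutFacts K κ (J * L) (L * i) (L * n) := by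
  intro n
  induction n with
  | zero => intro i _; rw [Nat.mul_zero]; exact trivial
  | succ n ih =>
    intro i h
    rw [Nat.mul_succ, Nat.add_comm (L * n) L]
    refine outFacts_append K κ (J * L) L (L * i) (L * n) ?_ ?_
    · exact outFacts_of_forall K κ (J * L) L (L * i) fun k hk => outOKV_of_outOKVL K κ h.1 hk
    · rw [← Nat.mul_succ]; exact ih (i + 1) h.2

/-- **BUCKETED OUTROUTE IS SOUND.** -/
theorem wardD4CertGe_of_outrouteL (K : SymCertR) (hwf : wellFormed K.expand = true)
    (hRok : K.gramR.all (gramBlockROK K.frame) = true) (κ : Word → ℕ) (J L : ℕ) (hJ : 0 < J) (hL : 0 < L)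
    (hfacts : OutFactsL K κ J L 0 J) : WardD4CertGe ((symValueR K : ℚ) : ℝ) := by
  refine wardD4CertGe_of_outroute K hwf hRok κ (J * L) (Nat.mul_pos hJ hL) ?_
  have h := outFacts_of_L K κ J L J 0 hfacts
  rwa [Nat.mul_zero, Nat.mul_comm L J] at h

/-- **Bucketed closing theorem (box canon).**  CLOSING GRAMMAR: per module `i < J` one file
`theorem out_i : outOKBL K κ J L lo hi i = true := by native_decide`; `hfacts := ⟨out_0, …, out_{J−1}, trivial⟩`. -/
theorem energyDensity_ge_of_outrouteBL (K : SymCertR) (hwf : wellFormed K.expand = true)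
    (hRok : K.gramR.all (gramBlockROK K.frame) = true) (κ : Word → ℕ) (J L : ℕ) (hJ : 0 < J) (hL : 0 < L)
    (lo hi : ℤ × ℤ) (hbox : boxLicence K.frame lo hi = true) (hfacts : OutFactsBL K κ J L lo hi 0 J) :
    ((symValueR K : ℚ) : ℝ) ≤ energyDensityTT' 1 0 8 (7 / 8) :=
  energyDensity_ge_of_windowSound_cert _ WardSlot.stub_wardWindowSound
    (wardD4CertGe_of_outrouteL K hwf hRok κ J L hJ hL (outFactsL_of_BL K κ J L hbox J 0 hfacts))

/-! ##### (h) SPEC FOR A FAST SKELETON: any executed share function `S` that is, module by module, a PERMUTATION of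
`shareR K κ J i` closes through the same chain (the engine proves `hS` once for its loop; order of emission is free). -/

/-- `polyOp` is invariant under permutation of the term list. -/
theorem polyOp_perm (Λ' : Finset (Site 2)) {p q : QPoly} (h : p.Perm q) : polyOp Λ' p = polyOp Λ' q := by
  rw [polyOp_eq_evalP, polyOp_eq_evalP]; exact evalP_perm _ h

/-- Per-module facts for an arbitrary executed share function `S` (V canon / box canon). -/
def OutFactsS (K : SymCertR) (S : ℕ → QPoly) : ℕ → ℕ → Prop
  | _, 0 => True
  | i, n + 1 => isZero (canonNFZV K.frame (S i)) = true ∧ OutFactsS K S (i + 1) n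

/-- Box facts of an arbitrary share function `S` for modules `i, …, i+n−1` (structural on `n`). -/
def OutFactsSB (K : SymCertR) (S : ℕ → QPoly) (lo hi : ℤ × ℤ) : ℕ → ℕ → Prop
  | _, 0 => True
  | i, n + 1 => isZero (canonNFZB lo hi (S i)) = true ∧ OutFactsSB K S lo hi (i + 1) n

/-- Box `S`-facts give frame-list `S`-facts (structural). -/
theorem outFactsS_of_B (K : SymCertR) (S : ℕ → QPoly) {lo hi : ℤ × ℤ} (h : boxLicence K.frame lo hi = true) :
    ∀ (n i : ℕ), OutFactsSB K S lo hi i n → OutFactsS K S i n := by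
  intro n
  induction n with
  | zero => intro i _; exact trivial
  | succ n ih => intro i hf; exact ⟨by rw [← canonNFZB_eq h (S i)]; exact hf.1, ih (i + 1) hf.2⟩

/-- `S`-facts give `…LocalB`'s two-list facts for the shares `S i, …` against EMPTY partials. -/
theorem facts₂Z_of_outFactsS (K : SymCertR) (S : ℕ → QPoly) :
    ∀ (n i : ℕ), OutFactsS K S i n → Facts₂Z K.toSymCert ((List.range' i n).map S) (List.replicate n []) := by
  intro n
  induction n with
  | zero => intro i _; exact trivial
  | succ n ih =>
    intro i h
    rw [List.range'_succ, List.map_cons, List.replicate_succ]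
    refine ⟨?_, ih (i + 1) h.2⟩
    rw [Bool.and_eq_true, psub_nil]
    exact ⟨rfl, h.1⟩

/-- **OUTROUTE with a substituted skeleton IS SOUND**: `S i ~ shareR K κ J i` for `i < J` + the `J` facts on `S`. -/
theorem wardD4CertGe_of_outrouteS (K : SymCertR) (hwf0 : wellFormed K.expand = true)
    (hRok : K.gramR.all (gramBlockROK K.frame) = true) (κ : Word → ℕ) (J : ℕ) (hJ : 0 < J) (S : ℕ → QPoly)
    (hS : ∀ i, i < J → (S i).Perm (shareR K κ J i)) (hfacts : OutFactsS K S 0 J) :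
    WardD4CertGe ((symValueR K : ℚ) : ℝ) := by
  have hwfb : wellFormed K.toSymCert = true := wellFormed_toSymCert_of_expand K hwf0
  have hmap : ∀ Λ' : Finset (Site 2), ((List.range J).map S).map (polyOp Λ') = (sharesR K κ J).map (polyOp Λ') := by
    intro Λ'
    rw [sharesR, List.map_map, List.map_map]
    refine List.map_congr_left fun i hi => ?_
    exact polyOp_perm Λ' (hS i (List.mem_range.mp hi))
  refine wardD4CertGe_of_facts₂ZR K hwf0 hRok ((List.range J).map S) (List.replicate J []) ?_
    (fun Λ' hFL => by rw [hmap Λ']; exact sum_sharesR K hwfb κ hJ hFL) ?_ ?_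
  · intro Q hQ
    rw [List.mem_map] at hQ
    obtain ⟨i, hi, rfl⟩ := hQ
    have hi' := List.mem_range.mp hi
    have hsh : PSupp (shareR K κ J i) K.frame.toFinset :=
      PSupp_sharesR K hwfb hRok κ J _ (by rw [sharesR, List.mem_map]; exact ⟨i, hi, rfl⟩)
    intro t ht
    exact hsh t ((hS i hi').mem_iff.mp ht)
  · rw [List.range_eq_range']
    exact facts₂Z_of_outFactsS K S J 0 hfacts
  · rw [List.flatten_replicate_nil]
    exact isZero_canonNFZV_nil K.frame

/-- Closing theorem for a substituted skeleton (box canon facts). -/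
theorem energyDensity_ge_of_outrouteSB (K : SymCertR) (hwf : wellFormed K.expand = true)
    (hRok : K.gramR.all (gramBlockROK K.frame) = true) (κ : Word → ℕ) (J : ℕ) (hJ : 0 < J) (S : ℕ → QPoly)
    (hS : ∀ i, i < J → (S i).Perm (shareR K κ J i)) (lo hi : ℤ × ℤ) (hbox : boxLicence K.frame lo hi = true)
    (hfacts : OutFactsSB K S lo hi 0 J) : ((symValueR K : ℚ) : ℝ) ≤ energyDensityTT' 1 0 8 (7 / 8) :=
  energyDensity_ge_of_windowSound_cert _ WardSlot.stub_wardWindowSound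
    (wardD4CertGe_of_outrouteS K hwf hRok κ J hJ S hS (outFactsS_of_B K S hbox J 0 hfacts))

/-! ##### (i) Toys: the bucketed form end to end (`J = 1` module, `L = 3` fine slots, box canon, `pairKey`), and the
substituted-skeleton theorem instantiated with `S := shareRF …` (a permutation of `shareR`, indeed equal). -/

example : ((symValueR toyRCert : ℚ) : ℝ) ≤ energyDensityTT' 1 0 8 (7 / 8) :=
  energyDensity_ge_of_outrouteBL toyRCert (by decide +kernel)
    (gramR_all_of_factsB toyRCert (minCornerP frame3) (maxCornerP frame3) (by decide +kernel) 2 (by decide +kernel)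
      ⟨by decide +kernel, by decide +kernel, trivial⟩)
    pairKey 1 3 Nat.one_pos (by norm_num) (minCornerP frame3) (maxCornerP frame3) (by decide +kernel)
    ⟨by decide +kernel, trivial⟩

example : ((symValueR toyRCert : ℚ) : ℝ) ≤ energyDensityTT' 1 0 8 (7 / 8) :=
  energyDensity_ge_of_outrouteSB toyRCert (by decide +kernel)
    (gramR_all_of_factsB toyRCert (minCornerP frame3) (maxCornerP frame3) (by decide +kernel) 2 (by decide +kernel)
      ⟨by decide +kernel, by decide +kernel, trivial⟩)
    netKey 3 (by norm_num) (shareRF toyRCert (toyRCert.gramR.map genBasis) netKey 3)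
    (fun i _ => by rw [shareRF_eq])
    (minCornerP frame3) (maxCornerP frame3) (by decide +kernel)
    ⟨by decide +kernel, by decide +kernel, by decide +kernel, trivial⟩

end Summit.Ventures.CertifiedManyBodySolver.Theorems.SymReplay

end
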